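import Summits.AtomisticToContinuum.HydrodynamicLimit.Theorems.AntiMazurCoboundariesKineticWindowGronwallPlusNode
import Summits.AtomisticToContinuum.HydrodynamicLimit.Theorems.AntiMazurCoboundariesKineticWindowGronwallFamilyGlueStub
import Summits.AtomisticToContinuum.HydrodynamicLimit.Theorems.AntiMazurCoboundariesKineticWindowGronwallProductKineticInstance
import Summits.AtomisticToContinuum.HydrodynamicLimit.Theorems.AntiMazurCoboundariesKineticWindowGronwallClockFromInstance
import HarnessLib

/-!
# The route-level split of crux `KineticWindowGronwall` (stmt-AtomisticToContinuum-9282) into three sub-cruxes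
# (crux-strategist decomposition, 2026-08-17; glue for `ledger route edit … --split KineticWindowGronwall --glue-by`)

Crux `Summit.AtomisticToContinuum.HydrodynamicLimit.Theses.AntiMazurCoboundaries.KineticWindowGronwall`
(`:= KineticFluxLdDecay → RelEntropyVanishing`, shared verbatim with route FluxGibbsianityLdDrude).

After leads c3–c5 of line `rare-band-ladder-dock` every PROVABLE piece of the kinetic-window relative-entropy method for this
crux is landed (`Theorems/AntiMazurCoboundariesKineticWindowGronwall…`: the amplitude ladder, the re-orthogonalising cut, the rare-band
dock on TwoClocks 14440, the family glue with its three helpers, the product kinetic instance, the clock from the instance, the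
`PlusNode` reductions). What is NOT landed is exactly the set of OPEN INPUTS of that composition. This file types them as three
statements over existing declarations — the children of the split — and proves, sorry-free, that they imply the crux BY NAME:

* `KineticWindowLDBoundsUniform` — THE LOCAL KINETIC NODE (reference-law window LD for general continuous fast one-body
  `F(x,v)` of quadratic growth under LOCAL Gibbs laws, tilt radius uniform over bounded profile classes, window clause
  `∃ τ₀ ∀ τ ≥ τ₀`; `Iff.rfl` with `Theorems.KineticWindowGronwallPlusNode.KineticWindowLDBoundsUniform`, here spelled out with
  fully qualified names so that it elaborates in the route file). It implies TwoClocks' docking node 14442 verbatim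
  (`KineticWindowGronwallPlusNode.kineticWindowLDUniform_of_uniform`) and the line's product node
  (`…localQuadraticWindowLDBounds_of_uniform`).
* `CoherentSuprathermalContentVanishesW` — the weighted coherent-suprathermal input of the landed clock, under the TRUE law
  (`Iff.rfl` with `Theorems.HydroLimitInBandOfHeart.CoherentSuprathermalContentVanishesW`; no board item carried it so far).
* `ClockBoardInputs` — the four remaining inputs of the landed clock, each ALREADY a board item, conjoined verbatim:
  the local transfer-clamped collisional window LD along families (text of OneFlightGossipEngine stmt-17691, `Iff.rfl` with
  `Theorems.HydroLimitInBandOfHeart.LocalClampedTransferWindowLDFamily`), TwoClocks `TransferActivityTails` (stmt-16624),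
  `EnergyCurrentTails` (stmt-9235) and `DiluteSelfConsistency` (stmt-3091).

Main theorem `kineticWindowGronwall_of_subs : KineticWindowLDBoundsUniform → CoherentSuprathermalContentVanishesW →
ClockBoardInputs → KineticWindowGronwall`. HONESTY (recorded by leads a1/c4/c5 and the strategist census): in this composition
the crux's antecedent `A = KineticFluxLdDecay` is idle — necessarily, since the local node at constant profiles contains the
global statement (`A ⇐ EquilibriumFastWindowLD ⇐` the node at constant data); A is load-bearing only relative to the strictly
weaker pair `(A, RareBandLdDecay)` of the landed ladder (`KineticWindowGronwallEndState.quadraticClass_iff`).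
-/

noncomputable section

namespace Summit.AtomisticToContinuum.HydrodynamicLimit.Theorems.KineticWindowGronwallSplit

open Summit.AtomisticToContinuum.HydrodynamicLimit.Theses.AntiMazurCoboundaries (KineticFluxLdDecay RelEntropyVanishing
  KineticWindowGronwall)

/-! ## §1 The three children (statements; texts identical to the `children.json` of the split) -/

/-- **CHILD 1 — THE LOCAL KINETIC NODE, BOUNDS-UNIFORM** (`Iff.rfl` with
`KineticWindowGronwallPlusNode.KineticWindowLDBoundsUniform`): there is a packing guard `η₀ > 0` such that for every temperature
range `0 < θm ≤ θM`, drift bound `U ≥ 0` and `σ > 0` there is ONE tilt radius `β₀ > 0` such that for every continuous local Gibbs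
datum `(a, θ₀, u₀)` within the bounds with `σ³·sup a ≤ η₀ ∫a`, every flow family, every continuous `F(x,v)` with
`|F(x,v)| ≤ 1 + ‖v‖²` orthogonal at every `x` under `M_(1,u₀(x),θ₀(x))` to `1, v_j, ‖v‖²`, every `|β| ≤ β₀` and `ε > 0`:
`∃ τ₀ ∀ τ ≥ τ₀ ∃ N₀ ∀ N ≥ N₀`, `∫ exp(β Σᵢ w⁻¹∫₀ʷ F(zᵢ(r)) dr) dλᴺ ≤ e^(ε(N+1))`, `w = τ(N+1)^(-1/3)`. Conjecture-grade. -/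
def KineticWindowLDBoundsUniform : Prop :=
  ∃ η₀ : ℝ, 0 < η₀ ∧ ∀ (θm θM U : ℝ), 0 < θm → θm ≤ θM → 0 ≤ U → ∀ σ : ℝ, 0 < σ → ∃ β₀ : ℝ, 0 < β₀ ∧ ∀ (a θ₀ : Literature.MathematicalPhysics.KineticTheory.T3 → ℝ) (u₀ : Literature.MathematicalPhysics.KineticTheory.T3 → Literature.MathematicalPhysics.KineticTheory.V3), Continuous a → Continuous θ₀ → Continuous u₀ → (∀ x, 0 < a x) → (∀ x, θm ≤ θ₀ x) → (∀ x, θ₀ x ≤ θM) → (∀ x, ‖u₀ x‖ ≤ U) → σ ^ 3 * (⨆ x, a x) ≤ η₀ * ∫ x, a x → ∀ Φ : (N : ℕ) → Literature.Analysis.FluidPDE.HardSphereFlow (Literature.Analysis.FluidPDE.Torus.geometry (Fin 3)) (Literature.MathematicalPhysics.KineticTheory.hsDiameter σ N) (N + 1), ∀ F : Literature.MathematicalPhysics.KineticTheory.T3 × Literature.MathematicalPhysics.KineticTheory.V3 → ℝ, Continuous F → (∀ y, |F y| ≤ 1 + ‖y.2‖ ^ 2) → (∀ x, ∫ v, F (x,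 v) * Literature.Analysis.FluidPDE.localMaxwellian 1 (θ₀ x) (u₀ x) v = 0) → (∀ x (j : Fin 3), ∫ v, F (x, v) * v j * Literature.Analysis.FluidPDE.localMaxwellian 1 (θ₀ x) (u₀ x) v = 0) → (∀ x, ∫ v, F (x, v) * ‖v‖ ^ 2 * Literature.Analysis.FluidPDE.localMaxwellian 1 (θ₀ x) (u₀ x) v = 0) → ∀ β : ℝ, |β| ≤ β₀ → ∀ ε : ℝ, 0 < ε → ∃ τ₀ : ℝ, 0 < τ₀ ∧ ∀ τ : ℝ, τ₀ ≤ τ → ∃ N₀ : ℕ, ∀ N : ℕ, N₀ ≤ N → ∫⁻ z, ENNReal.ofReal (Real.exp (β * ∑ i : Fin (N + 1), (τ * ((N : ℝ) + 1) ^ (-(1 / 3 : ℝ)))⁻¹ * ∫ r in (0 : ℝ)..(τ * ((N : ℝ) + 1) ^ (-(1 / 3 : ℝ))), F (((Φ N).flow r z) i))) ∂(Literature.MathematicalPhysics.KineticTheory.localGibbsLaw σ a u₀ θ₀ N (Φ N)) ≤ ENNReal.ofReal (Real.exp (ε * ((N : ℝ) + 1)))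

/-- **CHILD 2 — WEIGHTED COHERENT-SUPRATHERMAL CONTENT VANISHES UNDER THE TRUE LAW** (`Iff.rfl` with
`HydroLimitInBandOfHeart.CoherentSuprathermalContentVanishesW`): along the true evolution from the local Gibbs datum tied to a
classical hs-Euler solution, at a FIXED suprathermal threshold `K⋆`, for every bounded measurable radial weight `R(s,x,·)`
vanishing below `K⋆²`, the suprathermal cubic content carried by `(η, R)`-coherent particles vanishes in mean as `τ → ∞`.
Frame of `EnergyCurrentTails`. Conjecture-grade. -/
def CoherentSuprathermalContentVanishesW : Prop :=
  ∀ (a₀ θ₀ : Literature.MathematicalPhysics.KineticTheory.T3 → ℝ) (u₀ : Literature.MathematicalPhysics.KineticTheory.T3 → Literature.MathematicalPhysics.KineticTheory.V3), Continuous a₀ → Continuous θ₀ → Continuous u₀ → (∀ x, 0 < a₀ x) → (∀ x, 0 < θ₀ x) → ∃ σ₀ : ℝ, 0 < σ₀ ∧ ∀ σ : ℝ, 0 < σ → σ < σ₀ → ∀ (T : ℝ) (ρ θ : ℝ → Literature.MathematicalPhysics.KineticTheory.T3 → ℝ) (u : ℝ → Literature.MathematicalPhysics.KineticTheory.T3 →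 Literature.MathematicalPhysics.KineticTheory.V3), Literature.MathematicalPhysics.KineticTheory.IsHardSphereEulerSolution σ T ρ u θ → ∀ Φ : (N : ℕ) → Literature.Analysis.FluidPDE.HardSphereFlow (Literature.Analysis.FluidPDE.Torus.geometry (Fin 3)) (Literature.MathematicalPhysics.KineticTheory.hsDiameter σ N) (N + 1), Literature.MathematicalPhysics.KineticTheory.TendstoHydroFieldsAt (fun N => Literature.MathematicalPhysics.KineticTheory.localGibbsLaw σ a₀ u₀ θ₀ N (Φ N)) Φ ρ u θ 0 → ∀ t ∈ Set.Ico 0 T, ∃ Kstar : ℝ, 0 < Kstar ∧ ∀ R : ℝ → Literature.MathematicalPhysics.KineticTheory.T3 → ℝ → ℝ, Measurable (fun p : ℝ × Literature.MathematicalPhysics.KineticTheory.T3 × ℝ => R p.1 p.2.1 p.2.2) → (∀ s x s', s' ≤ Kstar ^ 2 → R s x s' = 0) → (∀ s x s', |R s x s'| ≤ |s'|) → ∀ η : ℝ, 0 < η → ∀ ε : ℝ, 0 < ε → ∃ τ₀ : ℝ, 0 < τ₀ ∧ ∀ τ : ℝ, τ₀ ≤ τ → ∃ N₀ : ℕ,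 ∀ N : ℕ, N₀ ≤ N → ∀ s ∈ Set.Icc 0 t, (let w : ℝ := τ * ((N : ℝ) + 1) ^ (-(1 / 3 : ℝ)); let P := Literature.MathematicalPhysics.KineticTheory.localGibbsLaw σ a₀ u₀ θ₀ N (Φ N); let W := fun (i : Fin (N + 1)) (s r : ℝ) (z : Literature.Analysis.FluidPDE.Config (N + 1) (Fin 3) Literature.MathematicalPhysics.KineticTheory.T3) => ((Φ N).flow r z i).2 - u s ((Φ N).flow r z i).1; let cub := fun (i : Fin (N + 1)) (s : ℝ) (z : Literature.Analysis.FluidPDE.Config (N + 1) (Fin 3) Literature.MathematicalPhysics.KineticTheory.T3) => w⁻¹ * ∫ r in s..(s + w), ‖W i s r z‖ ^ 3; let cubHi := fun (i : Fin (N + 1)) (s : ℝ) (z : Literature.Analysis.FluidPDE.Config (N + 1) (Fin 3) Literature.MathematicalPhysics.KineticTheory.T3) => w⁻¹ * ∫ r in s..(s + w), (if Kstar < ‖W i s r z‖ then ‖W i s r z‖ ^ 3 else 0); let qbar := fun (i : Fin (N + 1)) (s : ℝ) (z : Literature.Analysis.FluidPDE.Config (N + 1) (Fin 3) Literature.MathematicalPhysics.KineticTheory.T3)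 => w⁻¹ • ∫ r in s..(s + w), (R s ((Φ N).flow r z i).1 (‖W i s r z‖ ^ 2)) • W i s r z; ∫⁻ z, ENNReal.ofReal (((N : ℝ) + 1)⁻¹ * ∑ i : Fin (N + 1), (if η * cub i s z < ‖qbar i s z‖ then cubHi i s z else 0)) ∂P ≤ ENNReal.ofReal ε)

/-- **CHILD 3 — THE FOUR BOARD INPUTS OF THE LANDED CLOCK, CONJOINED VERBATIM**: the local transfer-clamped collisional window
LD along families (text of OneFlightGossipEngine stmt-17691; `Iff.rfl` with `HydroLimitInBandOfHeart.LocalClampedTransferWindowLDFamily`)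
∧ TwoClocks `TransferActivityTails` (stmt-16624) ∧ `EnergyCurrentTails` (stmt-9235) ∧ `DiluteSelfConsistency` (stmt-3091). A
bookkeeping conjunction: each conjunct is staffed on its own item. -/
def ClockBoardInputs : Prop :=
  (∃ η₀ : ℝ, 0 < η₀ ∧ ∀ (t₁ : ℝ) (a θ₀ : ℝ → Literature.MathematicalPhysics.KineticTheory.T3 → ℝ) (u₀ : ℝ → Literature.MathematicalPhysics.KineticTheory.T3 → Literature.MathematicalPhysics.KineticTheory.V3) (ha : ∀ s, Continuous (a s)), Continuous (Function.uncurry a) → Continuous (Function.uncurry θ₀) → Continuous (Function.uncurry u₀) → ∀ (ha0 : ∀ s x, 0 < a s x), (∀ s x, 0 < θ₀ s x) → ∀ σ : ℝ, 0 < σ → σ < 1 / 2 → (∀ s ∈ Set.Icc 0 t₁, σ ^ 3 * (⨆ x, a s x) ≤ η₀ * ∫ x, a s x) → ∀ Φ : (N : ℕ) → Literature.Analysis.FluidPDE.HardSphereFlow (Literature.Analysis.FluidPDE.Torus.geometry (Fin 3)) (Literature.MathematicalPhysics.KineticTheory.hsDiameter σ N) (N + 1), ∀ φ : ℝ → Literature.MathematicalPhysics.KineticTheory.T3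 → ℝ, Literature.Analysis.FunctionSpaces.Torus.IsSmoothSpaceTimeOn (Set.Icc 0 t₁) φ → ∃ V₀ : ℝ, 0 < V₀ ∧ ∀ V : ℝ, V₀ ≤ V → ∃ β₀ : ℝ, 0 < β₀ ∧ ∀ β : ℝ, |β| ≤ β₀ → ∀ ε : ℝ, 0 < ε → ∃ τ₀ : ℝ, 0 < τ₀ ∧ ∀ τ : ℝ, τ₀ ≤ τ → ∃ N₀ : ℕ, ∀ N : ℕ, N₀ ≤ N → ∀ s ∈ Set.Icc 0 t₁, (let ρ₀ : Literature.MathematicalPhysics.KineticTheory.T3 → ℝ := Literature.MathematicalPhysics.KineticTheory.rhoLim (Literature.MathematicalPhysics.KineticTheory.profileOf (a s) (ha s) (ha0 s)) σ; let w : ℝ := τ * ((N : ℝ) + 1) ^ (-(1 / 3 : ℝ)); let P := Literature.MathematicalPhysics.KineticTheory.localGibbsLaw σ (a s) (u₀ s) (θ₀ s) N (Φ N); let Z : Literature.MathematicalPhysics.KineticTheory.T3 → ℝ := fun x => Literature.MathematicalPhysics.KineticTheory.hsCompressibility (ρ₀ x * σ ^ 3); let Z' : Literature.MathematicalPhysics.KineticTheory.T3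 → ℝ := fun x => deriv Literature.MathematicalPhysics.KineticTheory.hsCompressibility (ρ₀ x * σ ^ 3); let act := fun (i : Fin (N + 1)) z => σ / τ * (Φ N).collisionSum (Set.Ioc 0 w) (fun c => if c.fst = i then ‖c.postVel.1 - c.preVel.1‖ + |‖c.postVel.1‖ ^ 2 - ‖c.preVel.1‖ ^ 2| / 2 else 0) z; let ω := fun (i : Fin (N + 1)) z => if act i z ≤ V then (1 : ℝ) else 0; let Xm := fun (k : Fin 3) z => (Φ N).collisionSum (Set.Ioc 0 w) (fun c => ω c.fst z * ω c.snd z * ((φ s c.fstPos - φ s c.sndPos) * (c.postVel.1 k - c.preVel.1 k)) / 2) z; let Am := fun (k : Fin 3) z => (∫ r in (0 : ℝ)..w, ∑ i : Fin (N + 1), Literature.Analysis.FunctionSpaces.Torus.partialDeriv k (φ s) ((Φ N).flow r z i).1 * (θ₀ s ((Φ N).flow r z i).1 * (ρ₀ ((Φ N).flow r z i).1 * σ ^ 3) * Z' ((Φ N).flow r z i).1 + (1 / 3) * (Z ((Φ N).flow r z i).1 - 1) * ‖((Φ N).flow r z i).2 - u₀ s ((Φ N).flow r z i).1‖ ^ 2))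 - w * ((N : ℝ) + 1) * ∫ x, ρ₀ x * Literature.Analysis.FunctionSpaces.Torus.partialDeriv k (φ s) x * (θ₀ s x * (ρ₀ x * σ ^ 3) * Z' x); let Xe := fun z => (Φ N).collisionSum (Set.Ioc 0 w) (fun c => ω c.fst z * ω c.snd z * ((φ s c.fstPos - φ s c.sndPos) * ((‖c.postVel.1‖ ^ 2 - ‖c.preVel.1‖ ^ 2) / 2)) / 2) z; let Ae := fun z => (∫ r in (0 : ℝ)..w, ∑ i : Fin (N + 1), ((∑ l : Fin 3, u₀ s ((Φ N).flow r z i).1 l * Literature.Analysis.FunctionSpaces.Torus.partialDeriv l (φ s) ((Φ N).flow r z i).1) * (θ₀ s ((Φ N).flow r z i).1 * (ρ₀ ((Φ N).flow r z i).1 * σ ^ 3) * Z' ((Φ N).flow r z i).1 + (1 / 3) * (Z ((Φ N).flow r z i).1 - 1) * ‖((Φ N).flow r z i).2 - u₀ s ((Φ N).flow r z i).1‖ ^ 2) + θ₀ s ((Φ N).flow r z i).1 * (Z ((Φ N).flow r z i).1 - 1) * (∑ l : Fin 3, Literature.Analysis.FunctionSpaces.Torus.partialDeriv l (φ s) ((Φ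 N).flow r z i).1 * (((Φ N).flow r z i).2 - u₀ s ((Φ N).flow r z i).1) l))) - w * ((N : ℝ) + 1) * ∫ x, ρ₀ x * (∑ l : Fin 3, u₀ s x l * Literature.Analysis.FunctionSpaces.Torus.partialDeriv l (φ s) x) * (θ₀ s x * (ρ₀ x * σ ^ 3) * Z' x); (∀ k : Fin 3, ∫⁻ z, ENNReal.ofReal (Real.exp (β * (w⁻¹ * Xm k z - w⁻¹ * Am k z))) ∂P ≤ ENNReal.ofReal (Real.exp (ε * ((N : ℝ) + 1)))) ∧ ∫⁻ z, ENNReal.ofReal (Real.exp (β * (w⁻¹ * Xe z - w⁻¹ * Ae z))) ∂P ≤ ENNReal.ofReal (Real.exp (ε * ((N : ℝ) + 1))))) ∧ (∀ (a₀ θ₀ : Literature.MathematicalPhysics.KineticTheory.T3 → ℝ) (u₀ : Literature.MathematicalPhysics.KineticTheory.T3 → Literature.MathematicalPhysics.KineticTheory.V3), Continuous a₀ → Continuous θ₀ → Continuous u₀ → (∀ x, 0 < a₀ x) → (∀ x, 0 < θ₀ x) → ∃ σ₀ : ℝ, 0 < σ₀ ∧ ∀ σ : ℝ, 0 < σ →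 σ < σ₀ → ∀ (T : ℝ) (ρ θ : ℝ → Literature.MathematicalPhysics.KineticTheory.T3 → ℝ) (u : ℝ → Literature.MathematicalPhysics.KineticTheory.T3 → Literature.MathematicalPhysics.KineticTheory.V3), Literature.MathematicalPhysics.KineticTheory.IsHardSphereEulerSolution σ T ρ u θ → ∀ Φ : (N : ℕ) → Literature.Analysis.FluidPDE.HardSphereFlow (Literature.Analysis.FluidPDE.Torus.geometry (Fin 3)) (Literature.MathematicalPhysics.KineticTheory.hsDiameter σ N) (N + 1), Literature.MathematicalPhysics.KineticTheory.TendstoHydroFieldsAt (fun N => Literature.MathematicalPhysics.KineticTheory.localGibbsLaw σ a₀ u₀ θ₀ N (Φ N)) Φ ρ u θ 0 → ∀ t ∈ Set.Ico 0 T, ∃ V₀ : ℝ, 0 < V₀ ∧ ∀ V : ℝ, V₀ ≤ V → ∀ ε : ℝ, 0 < ε → ∃ τ₀ : ℝ, 0 < τ₀ ∧ ∀ τ : ℝ, τ₀ ≤ τ → ∃ N₀ : ℕ, ∀ N : ℕ, N₀ ≤ N → ∀ s ∈ Set.Icc 0 t, (let w : ℝ := τ * ((N : ℝ) + 1) ^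 (-(1 / 3 : ℝ)); let P := Literature.MathematicalPhysics.KineticTheory.localGibbsLaw σ a₀ u₀ θ₀ N (Φ N); let act := fun (i : Fin (N + 1)) (z : Literature.Analysis.FluidPDE.Config (N + 1) (Fin 3) Literature.MathematicalPhysics.KineticTheory.T3) => σ / τ * (Φ N).collisionSum (Set.Ioc s (s + w)) (fun c => if c.fst = i then ‖c.postVel.1 - c.preVel.1‖ + |‖c.postVel.1‖ ^ 2 - ‖c.preVel.1‖ ^ 2| / 2 else 0) z; ∫⁻ z, ENNReal.ofReal (((N : ℝ) + 1)⁻¹ * ∑ i : Fin (N + 1), Set.indicator {y : ℝ | V < y} (fun y => y) (act i z)) ∂P ≤ ENNReal.ofReal ε)) ∧ (∀ (a₀ θ₀ : Literature.MathematicalPhysics.KineticTheory.T3 → ℝ) (u₀ : Literature.MathematicalPhysics.KineticTheory.T3 → Literature.MathematicalPhysics.KineticTheory.V3), Continuous a₀ → Continuous θ₀ → Continuous u₀ → (∀ x, 0 < a₀ x) → (∀ x, 0 < θ₀ x) → ∃ σ₀ : ℝ, 0 < σ₀ ∧ ∀ σ : ℝ, 0 < σ → σ < σ₀ → ∀ (T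 : ℝ) (ρ θ : ℝ → Literature.MathematicalPhysics.KineticTheory.T3 → ℝ) (u : ℝ → Literature.MathematicalPhysics.KineticTheory.T3 → Literature.MathematicalPhysics.KineticTheory.V3), Literature.MathematicalPhysics.KineticTheory.IsHardSphereEulerSolution σ T ρ u θ → ∀ Φ : (N : ℕ) → Literature.Analysis.FluidPDE.HardSphereFlow (Literature.Analysis.FluidPDE.Torus.geometry (Fin 3)) (Literature.MathematicalPhysics.KineticTheory.hsDiameter σ N) (N + 1), Literature.MathematicalPhysics.KineticTheory.TendstoHydroFieldsAt (fun N => Literature.MathematicalPhysics.KineticTheory.localGibbsLaw σ a₀ u₀ θ₀ N (Φ N)) Φ ρ u θ 0 → ∀ t ∈ Set.Ico 0 T, ∀ ε : ℝ, 0 < ε → ∃ M : ℝ, ∃ N₀ : ℕ, ∀ N : ℕ, N₀ ≤ N → ∀ s ∈ Set.Icc 0 t, ∫⁻ z, ENNReal.ofReal (((N : ℝ) + 1)⁻¹ * ∑ i : Fin (N + 1), Set.indicator {v : Literature.MathematicalPhysics.KineticTheory.V3 | M < ‖v‖} (fun v => ‖v‖ ^ 3) (((Φ N).flow s z i).2))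 ∂(Literature.MathematicalPhysics.KineticTheory.localGibbsLaw σ a₀ u₀ θ₀ N (Φ N)) ≤ ENNReal.ofReal ε) ∧ (∀ η : ℝ, 0 < η → ∀ (a₀ θ₀ : Literature.MathematicalPhysics.KineticTheory.T3 → ℝ) (u₀ : Literature.MathematicalPhysics.KineticTheory.T3 → Literature.MathematicalPhysics.KineticTheory.V3), Continuous a₀ → Continuous θ₀ → Continuous u₀ → (∀ x, 0 < a₀ x) → (∀ x, 0 < θ₀ x) → ∃ σ₀ : ℝ, 0 < σ₀ ∧ ∀ σ : ℝ, 0 < σ → σ < σ₀ → ∀ (T : ℝ) (ρ θ : ℝ → Literature.MathematicalPhysics.KineticTheory.T3 → ℝ) (u : ℝ → Literature.MathematicalPhysics.KineticTheory.T3 → Literature.MathematicalPhysics.KineticTheory.V3), Literature.MathematicalPhysics.KineticTheory.IsHardSphereEulerSolution σ T ρ u θ → ∀ Φ : (N : ℕ) → Literature.Analysis.FluidPDE.HardSphereFlow (Literature.Analysis.FluidPDE.Torus.geometry (Fin 3)) (Literature.MathematicalPhysics.KineticTheory.hsDiameter σ N) (N + 1), Literature.MathematicalPhysics.KineticTheory.TendstoHydroFieldsAt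 (fun N => Literature.MathematicalPhysics.KineticTheory.localGibbsLaw σ a₀ u₀ θ₀ N (Φ N)) Φ ρ u θ 0 → ∀ t ∈ Set.Ico 0 T, ∀ x, ρ t x * σ ^ 3 < η)

/-! ## §2 The children are the landed statements (same terms) -/

/-- Child 1 is `KineticWindowGronwallPlusNode.KineticWindowLDBoundsUniform` (same term). [folklore] -/
theorem kineticWindowLDBoundsUniform_iff :
    KineticWindowLDBoundsUniform ↔ KineticWindowGronwallPlusNode.KineticWindowLDBoundsUniform :=
  Iff.rfl

/-- Child 2 is the heart's `CoherentSuprathermalContentVanishesW` (same term). [folklore] -/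
theorem coherentSuprathermalContentVanishesW_iff :
    CoherentSuprathermalContentVanishesW ↔ HydroLimitInBandOfHeart.CoherentSuprathermalContentVanishesW :=
  Iff.rfl

/-- Child 3 is the conjunction of the heart's `LocalClampedTransferWindowLDFamily` and TwoClocks' `TransferActivityTails`,
`EnergyCurrentTails`, `DiluteSelfConsistency` (same terms). [folklore] -/
theorem clockBoardInputs_iff :
    ClockBoardInputs ↔
      (HydroLimitInBandOfHeart.LocalClampedTransferWindowLDFamily ∧
        Summit.AtomisticToContinuum.HydrodynamicLimit.Theses.TwoClocks.TransferActivityTails ∧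
        Summit.AtomisticToContinuum.HydrodynamicLimit.Theses.TwoClocks.EnergyCurrentTails ∧
        Summit.AtomisticToContinuum.HydrodynamicLimit.Theses.TwoClocks.DiluteSelfConsistency) :=
  Iff.rfl

/-! ## §3 The split glue: the three children imply the crux BY NAME -/

/-- From child 1 to the line's family node: the bounds-uniform general-`F` node gives the profile-wise product node
(`KineticWindowGronwallPlusNode.localQuadraticWindowLDBounds_of_uniform`, landed) and the family glue (landed with its three
helpers, `KineticWindowGronwallFamilyGlue.stub_familyGlue`) gives the family node. [folklore] -/
theorem localQuadraticWindowLDFamily_of_child₁ (h₁ : KineticWindowLDBoundsUniform) :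
    KineticWindowGronwallFamilyGlue.LocalQuadraticWindowLDFamily :=
  KineticWindowGronwallFamilyGlue.stub_familyGlue
    (KineticWindowGronwallPlusNode.localQuadraticWindowLDBounds_of_uniform (kineticWindowLDBoundsUniform_iff.1 h₁))

/-- The crux's consequent from the three children: product kinetic instance (landed) and clock from the instance (landed).
[cite: OllaVaradhanYau1993, §2–3] -/
theorem relEntropyVanishing_of_subs (h₁ : KineticWindowLDBoundsUniform) (h₂ : CoherentSuprathermalContentVanishesW)
    (h₃ : ClockBoardInputs) : RelEntropyVanishing :=
  KineticWindowGronwallClockFromInstance.stub_clockFromInstance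
    (KineticWindowGronwallProductKineticInstance.stub_productKineticInstance (localQuadraticWindowLDFamily_of_child₁ h₁))
    h₃.1 h₂ h₃.2.1 h₃.2.2.1 h₃.2.2.2

/-- **THE SPLIT GLUE** (`--glue-by` decl): `KineticWindowLDBoundsUniform → CoherentSuprathermalContentVanishesW → ClockBoardInputs →
KineticWindowGronwall`. The antecedent `KineticFluxLdDecay` is not used (see the module docstring). [cite: OllaVaradhanYau1993, §2–3] -/
theorem kineticWindowGronwall_of_subs (h₁ : KineticWindowLDBoundsUniform) (h₂ : CoherentSuprathermalContentVanishesW)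
    (h₃ : ClockBoardInputs) : KineticWindowGronwall :=
  fun _ => relEntropyVanishing_of_subs h₁ h₂ h₃

/-- The same for the item's primary decl (route FluxGibbsianityLdDrude shares stmt-9282 verbatim; same term). [folklore] -/
theorem kineticWindowGronwall_of_subs' (h₁ : KineticWindowLDBoundsUniform) (h₂ : CoherentSuprathermalContentVanishesW)
    (h₃ : ClockBoardInputs) :
    Summit.AtomisticToContinuum.HydrodynamicLimit.Theses.FluxGibbsianityLdDrude.KineticWindowGronwall :=
  kineticWindowGronwall_of_subs h₁ h₂ h₃

/-- Child 1 also gives TwoClocks' docking node `KineticWindowLDUniform` (stmt-14442) verbatim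
(`KineticWindowGronwallPlusNode.kineticWindowLDUniform_of_uniform`, landed) — the node is shared content, not this route's alone. [folklore] -/
theorem kineticWindowLDUniform_of_child₁ (h₁ : KineticWindowLDBoundsUniform) :
    Summit.AtomisticToContinuum.HydrodynamicLimit.Theses.TwoClocks.KineticWindowLDUniform :=
  KineticWindowGronwallPlusNode.kineticWindowLDUniform_of_uniform (kineticWindowLDBoundsUniform_iff.1 h₁)

end Summit.AtomisticToContinuum.HydrodynamicLimit.Theorems.KineticWindowGronwallSplit

end
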